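import Summits.HubbardSuperconductivity.HubbardSuperconductivity.Theorems.BirComplexStableXY.Negative.WitnessTable

/-!
# Sketch — crux-ideate r2 ideator 6, crux `BirComplexStableXYR` (stmt-HubbardSuperconductivity-14845)

Idea `torus-three-factor-form`: an EXACT, lift-free rewriting of every admissible (R)∧(P) window weight on
the torus as  (positive coercive real weight) × (explicit topological phase of an INTEGER flux functional)
× (bounded unimodular cubic spectator).  First lemmas as Props over the landed vocabulary
`BirComplexStableXYNegative.{W, Freq, Table, Λ, genF, sh, action, cube, partZ, normA}`; the disprover's
`Cond*` are re-declared verbatim.  What is PROVED here (no sorry): the pure-logic transfer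
`birComplexStableXYR_of_I3` — the crux follows from (a) the in-class quadratic normal form
`CubicNormalForm` and (b) the crux restricted to tables whose imaginary Hessian at the constants vanishes.

* `ImQuadZero c`      — (I3): the imaginary part of `F = genF c` has NO quadratic Taylor term at constants.
* `BerryFree c`       — the imaginary part has no linear Taylor term either (no Berry current).
* `CubicNormalForm r` — FIRST LEMMA (M-sized, elementary): for every (U1)(R)(P) table `c` there is a table
      `c'` with the SAME real part, the SAME action on EVERY torus `(ℤ/L)²×ℤ/M`, (U1)(R)(P) kept, (N) kept,
      `normA c' ≤ C_r·normA c`, and (I3).  Construction: `c' = c − i·(pair-cosine table of the Im-Hessian)`;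
      the translate-sum of that pair-cosine function vanishes identically because the Im-Hessian is odd under
      the window inversion R∘P (landed `quadForm_eq_zero_of_odd_even`, here at TABLE level: `A_d = −A_{−d}`).
* `PvFluxInteger`     — for every torus configuration and displacement `d`, `Σ_y pv(θ(y+d) − θ(y)) ∈ 2πℤ`
      (`pv` = `toIocMod` into `(−π, π]`): the lift-free INTEGER FLUX `N_d(θ)` (windings + projected
      vortex-loop areas) through which — and only through which — the linear (Berry) imaginary part acts.
* `CubicImRemainder r`, `SpectatorBound r` — for (I3) ∧ Berry-free tables: `|Im F(φ)| ≤ C_r·normA·osc³`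
      and the pointwise bound `‖e^{−K F} − e^{−K Re F}‖ ≤ C_r B c₀^{−3/2} K^{−1/2}` from (C).
* `birComplexStableXYR_of_I3` (theorem): `(∀ r, CubicNormalForm r) → EngineClaimR AdmissibleRPI3 →
      BirComplexStableXYR`.
-/

set_option linter.dupNamespace false

namespace Summit.HubbardSuperconductivity.HubbardSuperconductivity.Cruxes.BirComplexStableXYR.ThreeFactor

open scoped BigOperators ComplexConjugate
open MeasureTheory Literature.Probability.LatticeModels
open Summit.HubbardSuperconductivity.HubbardSuperconductivity.Theses.BalabanIR
open Summit.HubbardSuperconductivity.BirComplexStableXYNegative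

noncomputable section

/-! ### verbatim copies of the disprover's named pieces (Cruxes/BirComplexStableXYR/Disproof.lean §1) -/

/-- the equal-time slice order observable `O(θ) = |Σ_x e^{iθ(x,0)}|² / L⁴`. -/
def sliceO (L M : ℕ) [NeZero L] [NeZero M] (θ : Λ L M → ℝ) : ℝ :=
  ‖∑ x : TorusSite 2 L, Complex.exp (Complex.I * (θ (x, 0) : ℂ))‖ ^ 2 / (L : ℝ) ^ 4

/-- the numerator `∫_cube O e^{-A}`. -/
def numerO {r : ℕ} (K : ℝ) (c : Table r) (L M : ℕ) [NeZero L] [NeZero M] : ℂ :=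
  MeasureTheory.integral (MeasureTheory.volume.restrict (cube L M))
    (fun θ => (sliceO L M θ : ℂ) * Complex.exp (-(action K c L M θ)))

/-- the crux's conclusion for given data: `Z ≠ 0` and `Re ⟨O⟩ ≥ 1/2`. -/
def Conclusion {r : ℕ} (K : ℝ) (c : Table r) (L M : ℕ) [NeZero L] [NeZero M] : Prop :=
  partZ K c L M ≠ 0 ∧ (1/2 : ℝ) ≤ (numerO K c L M / partZ K c L M).re

def CondU1 {r : ℕ} (c : Table r) : Prop := ∀ n ∈ c.support, ∑ w, n w = 0
def CondN {r : ℕ} (c : Table r) : Prop := c.sum (fun _ a => a) = 0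
def CondA {r : ℕ} (B : ℝ) (c : Table r) : Prop :=
  c.sum (fun n a => ‖a‖ * Real.exp (∑ w, |(n w : ℝ)|)) ≤ B
def CondC {r : ℕ} (c₀ : ℝ) (c : Table r) : Prop :=
  ∀ φ : W r → ℝ, c₀ * ∑ w, ∑ w', (1 - Real.cos (φ w - φ w')) ≤ (genF c φ).re
/-- (R) time-reflection (Osterwalder–Schrader) Hermiticity of the table. -/
def CondR {r : ℕ} (c : Table r) : Prop :=
  ∀ n : Freq r, c (fun w => n (w.1, w.2.1, Fin.rev w.2.2)) = (starRingEnd ℂ) (c (-n))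
/-- (P) spatial-inversion evenness of the table. -/
def CondP {r : ℕ} (c : Table r) : Prop :=
  ∀ n : Freq r, c (fun w => n (Fin.rev w.1, Fin.rev w.2.1, w.2.2)) = c n
/-- the restated crux's admissible class. -/
def AdmissibleRP (r : ℕ) (B c₀ : ℝ) (c : Table r) : Prop :=
  CondU1 c ∧ CondN c ∧ CondA B c ∧ CondC c₀ c ∧ CondR c ∧ CondP c

/-- the restated engine claim over an arbitrary class `P` of tables (conclusion at even `L ≤ M`). -/
def EngineClaimR (P : (r : ℕ) → ℝ → ℝ → Table r → Prop) : Prop :=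
  ∀ (r : ℕ) (B c₀ : ℝ), 2 ≤ r → 0 < c₀ → ∃ K₀ : ℝ, ∃ L₀ : ℕ, ∀ K : ℝ, K₀ ≤ K →
    ∀ c : Table r, P r B c₀ c → ∀ (L M : ℕ) [NeZero L] [NeZero M], L₀ ≤ L → L ≤ M → Even L → Even M →
      Conclusion K c L M

/-! ### the idea's objects -/

/-- (I3) the imaginary part of `F` has no quadratic Taylor term at the constants:
the quadratic form `v ↦ Σ_n (Im c_n) (n·v)²` (= minus the Im-Hessian) vanishes. -/
def ImQuadZero {r : ℕ} (c : Table r) : Prop :=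
  ∀ v : W r → ℝ, (c.sum (fun n a => a.im * (∑ w, (n w : ℝ) * v w) ^ 2)) = 0

/-- Berry-free: the imaginary part of `F` has no LINEAR Taylor term at the constants
(`d/dt Im F(t v)|₀ = Σ_n (Re c_n)(n·v)`). -/
def BerryFree {r : ℕ} (c : Table r) : Prop :=
  ∀ v : W r → ℝ, (c.sum (fun n a => a.re * (∑ w, (n w : ℝ) * v w))) = 0

/-- the (I3) subclass of the admissible (R)∧(P) class. -/
def AdmissibleRPI3 (r : ℕ) (B c₀ : ℝ) (c : Table r) : Prop :=
  AdmissibleRP r B c₀ c ∧ ImQuadZero c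

/-- FIRST LEMMA (elementary, table-level): the quadratic imaginary part is removable INSIDE the class,
with the action unchanged on every torus and the real part unchanged pointwise. -/
def CubicNormalForm (r : ℕ) : Prop :=
  ∃ Cr : ℝ, 1 ≤ Cr ∧ ∀ c : Table r, CondU1 c → CondR c → CondP c →
    ∃ c' : Table r, CondU1 c' ∧ CondR c' ∧ CondP c' ∧ (CondN c → CondN c') ∧
      (∀ B : ℝ, CondA B c → CondA (Cr * B) c') ∧
      (∀ φ : W r → ℝ, (genF c' φ).re = (genF c φ).re) ∧
      (∀ (K : ℝ) (L M : ℕ) [NeZero L] [NeZero M] (θ : Λ L M → ℝ), action K c' L M θ = action K c L M θ) ∧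
      ImQuadZero c'

/-- principal value of an angle difference, in `(−π, π]`. -/
def pv (x : ℝ) : ℝ := toIocMod Real.two_pi_pos (-Real.pi) x

/-- LIFT-FREE INTEGER FLUX: on every torus and for every displacement `d`, the sum of principal-value
differences along `d` is an integer multiple of `2π` (it telescopes for any real lift). -/
def PvFluxInteger : Prop :=
  ∀ (L M : ℕ) [NeZero L] [NeZero M] (θ : Λ L M → ℝ) (d : Λ L M),
    ∃ N : ℤ, (∑ y : Λ L M, pv (θ (y + d) - θ y)) = 2 * Real.pi * N

/-- cubic remainder: for (U1) ∧ (I3) ∧ Berry-free tables the imaginary part is third order in the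
oscillation (Taylor + the (A)-weighted moment bound `|n|₁³ ≤ (3/e)³ e^{|n|₁}`). -/
def CubicImRemainder (r : ℕ) : Prop :=
  ∃ Cr : ℝ, ∀ c : Table r, CondU1 c → ImQuadZero c → BerryFree c →
    ∀ (φ : W r → ℝ) (m δ : ℝ), 0 ≤ δ → (∀ w, |φ w - m| ≤ δ) → |(genF c φ).im| ≤ Cr * normA c * δ ^ 3

/-- SPECTATOR BOUND: for (U1)(N)(A)(C) ∧ (I3) ∧ Berry-free tables the complex window weight differs from
its positive real-part weight by `O(B c₀^{−3/2} K^{−1/2})` POINTWISE on the whole window torus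
(`sup_x e^{−(2c₀K/π²)x²} · K C B x³`); no core, no lift. -/
def SpectatorBound (r : ℕ) : Prop :=
  ∃ Cr : ℝ, ∀ (B c₀ K : ℝ) (c : Table r), 0 < c₀ → 1 ≤ K →
    CondU1 c → CondN c → CondA B c → CondC c₀ c → ImQuadZero c → BerryFree c →
    ∀ φ : W r → ℝ,
      ‖Complex.exp (-((K : ℂ) * genF c φ)) - Complex.exp (-((K : ℂ) * ((genF c φ).re : ℂ)))‖
        ≤ Cr * B / (c₀ * Real.sqrt c₀ * Real.sqrt K)

/-! ### the pure-logic transfer (proved) -/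

theorem partZ_congr {r : ℕ} {K : ℝ} {c c' : Table r} {L M : ℕ} [NeZero L] [NeZero M]
    (h : ∀ θ : Λ L M → ℝ, action K c' L M θ = action K c L M θ) :
    partZ K c' L M = partZ K c L M := by
  unfold partZ
  congr 1
  funext θ
  rw [h θ]

theorem numerO_congr {r : ℕ} {K : ℝ} {c c' : Table r} {L M : ℕ} [NeZero L] [NeZero M]
    (h : ∀ θ : Λ L M → ℝ, action K c' L M θ = action K c L M θ) :
    numerO K c' L M = numerO K c L M := by
  unfold numerO
  congr 1
  funext θ
  rw [h θ]

theorem conclusion_congr {r : ℕ} {K : ℝ} {c c' : Table r} {L M : ℕ} [NeZero L] [NeZero M]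
    (h : ∀ θ : Λ L M → ℝ, action K c' L M θ = action K c L M θ) :
    Conclusion K c' L M ↔ Conclusion K c L M := by
  unfold Conclusion
  rw [partZ_congr h, numerO_congr h]

/-- The re-expression is faithful (definitional up to currying; copied from the disprover's `engineClaimR_iff`). -/
theorem engineClaimR_iff : EngineClaimR AdmissibleRP ↔ BirComplexStableXYR := by
  constructor
  · intro h r B c₀ hr hc₀
    obtain ⟨K₀, L₀, hK⟩ := h r B c₀ hr hc₀
    refine ⟨K₀, L₀, fun K hKK c h1 h2 h3 h4 h5 h6 L M _ _ hL hLM hLe hMe => ?_⟩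
    have key := hK K hKK c ⟨h1, h2, h3, h4, h5, h6⟩ L M hL hLM hLe hMe
    dsimp only [Conclusion, partZ, numerO, action, genF, sh, cube, sliceO] at key
    dsimp only
    exact key
  · intro h r B c₀ hr hc₀
    obtain ⟨K₀, L₀, hK⟩ := h r B c₀ hr hc₀
    refine ⟨K₀, L₀, fun K hKK c hc L M _ _ hL hLM hLe hMe => ?_⟩
    have key := hK K hKK c hc.1 hc.2.1 hc.2.2.1 hc.2.2.2.1 hc.2.2.2.2.1 hc.2.2.2.2.2 L M hL hLM hLe hMe
    dsimp only at key
    dsimp only [Conclusion, partZ, numerO, action, genF, sh, cube, sliceO]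
    exact key

/-- **Transfer (sorry-free).**  The crux follows from the in-class quadratic normal form and the crux
restricted to (I3) tables: WLOG the imaginary part of every admissible window action starts with the
(Berry) linear term plus CUBIC terms. -/
theorem birComplexStableXYR_of_I3 (hNF : ∀ r, CubicNormalForm r)
    (hE : EngineClaimR AdmissibleRPI3) : BirComplexStableXYR := by
  rw [← engineClaimR_iff]
  intro r B c₀ hr hc₀
  obtain ⟨Cr, hCr, hnf⟩ := hNF r
  obtain ⟨K₀, L₀, hK⟩ := hE r (Cr * B) c₀ hr hc₀
  refine ⟨K₀, L₀, fun K hKK c hc L M _ _ hL hLM hLe hMe => ?_⟩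
  obtain ⟨h1, h2, h3, h4, h5, h6⟩ := hc
  obtain ⟨c', g1, g5, g6, g2, g3, gre, gact, gI3⟩ := hnf c h1 h5 h6
  have hC' : CondC c₀ c' := fun φ => by rw [gre φ]; exact h4 φ
  have hadm : AdmissibleRPI3 r (Cr * B) c₀ c' := ⟨⟨g1, g2 h2, g3 B h3, hC', g5, g6⟩, gI3⟩
  have key := hK K hKK c' hadm L M hL hLM hLe hMe
  exact (conclusion_congr (gact K L M)).1 key

end

end Summit.HubbardSuperconductivity.HubbardSuperconductivity.Cruxes.BirComplexStableXYR.ThreeFactor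

/-! ### appendix (proved): the lift-free integer flux -/

namespace Summit.HubbardSuperconductivity.HubbardSuperconductivity.Cruxes.BirComplexStableXYR.ThreeFactor

open scoped BigOperators
open Literature.Probability.LatticeModels
open Summit.HubbardSuperconductivity.BirComplexStableXYNegative

/-- `PvFluxInteger` holds: `Σ_y pv(θ(y+d) − θ(y)) = 2π·N` with `N = −Σ_y toIocDiv …` (the plain differences
telescope along the bijection `y ↦ y + d` of the torus). -/
theorem pvFluxInteger_holds : PvFluxInteger := by
  intro L M _ _ θ d
  refine ⟨-∑ y : Λ L M, toIocDiv Real.two_pi_pos (-Real.pi) (θ (y + d) - θ y), ?_⟩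
  have tele : ∑ y : Λ L M, (θ (y + d) - θ y) = 0 := by
    rw [Finset.sum_sub_distrib, sub_eq_zero]
    exact Fintype.sum_equiv (Equiv.addRight d) _ _ (fun y => rfl)
  have key : ∀ y : Λ L M, pv (θ (y + d) - θ y) =
      (θ (y + d) - θ y) - toIocDiv Real.two_pi_pos (-Real.pi) (θ (y + d) - θ y) • (2 * Real.pi) := by
    intro y
    unfold pv
    rw [self_sub_toIocDiv_zsmul]
  rw [Finset.sum_congr rfl (fun y _ => key y), Finset.sum_sub_distrib, tele, zero_sub]
  simp only [zsmul_eq_mul]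
  rw [← Finset.sum_mul]
  push_cast
  ring

end Summit.HubbardSuperconductivity.HubbardSuperconductivity.Cruxes.BirComplexStableXYR.ThreeFactor
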